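import Summits.ResolutionOfSingularities.ResolutionOfSingularities.Theorems.RadicialJungCleanModelsSufficeChartsFamily
import Summits.ResolutionOfSingularities.ResolutionOfSingularities.Theorems.PAlterationPicoverTowerTransport
import Mathlib.AlgebraicGeometry.Noetherian

/-!
# Route `RadicialJung`, crux `CleanModelsSuffice`, line `Sketch`: the stub `stub_charts` —
# pointwise Kato charts on the normalisation of an adapted log-clean model

Registered stub `stub_charts` of the skeleton of
`Summit.ResolutionOfSingularities.ResolutionOfSingularities.Theses.RadicialJung.CleanModelsSuffice`
(stmt-ResolutionOfSingularities-15883), proved by assembling the helper files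
`RadicialJungCleanModelsSufficeCharts{Monoid,Kummer,Compat,Field,StalkIso,CaseA,Data,Point,Sections,
Overlap,Family}.lean`:

* `V^L = normalizationIn V L` is locally Noetherian: `V` is (finite type over a field) and
  `V^L → V` is finite (`isFinite_normalizationInι`, E. Noether), hence locally of finite type.
* The charts (`AdaptedData.chart`): at a TOROIDAL point `v` of the adapted data `hR` (bundled as
  `AdaptedData`), normalise the exponents in `𝒪_{V,v}` (`hNorm`) and take the Kummer chart
  `c ↦ y'^{c₀} ∏_{i≠0} s_i^{c_i}` on the Kummer monoid `P_{a'}` (fs: `kummerMonoid_fs`), realised by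
  sections of `V^L` over `ι⁻¹ U'` (`U' ∋ v` affine inside `U v`) because its values are integral
  over `Γ(V, U')`; at a point of REGULAR type the trivial chart.
* Log regularity at `x` over `w` (`AdaptedData.isLogRegularLocal_chart`): `𝒪_{V^L,x}` is
  `integralClosure 𝒪_{V,w} L` (local at every `w`), compatibly with values in `L`; if a charged
  section of the chart vanishes at `w` (Case A) the Kummer order at `w` is local, finite, with
  fraction field `L` (`hStruct`) and log regular (`hLogReg`, the charged sections through `w` being
  jointly part of a regular system by JOINTSOP), hence normal (`hK4`, Kato 1994 (4.1)), hence the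
  whole integral closure — so the chart is log regular at `x`; otherwise (Case B) the chart is by
  units at `x` and `w` is of regular type (OVERLAP), where `V^L` is regular.
* Compatibility (`AdaptedData.chart_compatible`): OVERLAP matches the charged sections of two
  charts through `w` up to units with proportional exponents, whence matching weight monomials
  (`exists_associated_weightMonomial`) and chart values differing by units of the integral
  closure (comparison of `p`-th powers).

The hypotheses `hIdeal`, `hAddFree`, `hMonoid`, `hSop` (finer local algebra for charts that also
record the uncharged boundary coordinates) are not needed for the charts built here, which record
the charged coordinates only; they are acknowledged and left unused.
-/

noncomputable section

set_option linter.dupNamespace false -- mandated namespace of this single-conjunct summit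

open CategoryTheory CategoryTheory.Limits AlgebraicGeometry TopologicalSpace
open Literature.AlgebraicGeometry.Resolution Literature.AlgebraicGeometry.Motives

namespace Summit.ResolutionOfSingularities.ResolutionOfSingularities.Theorems.RadicialJung.CleanModelsSuffice

/-- **The normalisation of a variety in a degree-`p` extension of its function field is locally
Noetherian**: `V` is locally Noetherian (locally of finite type over a field) and `V^L → V` is
finite (E. Noether, `isFinite_normalizationInι`), hence locally of finite type. [folklore] -/
theorem isLocallyNoetherian_normalizationIn_of_finrank (p : ℕ) (hp : p.Prime) (k : Type) [Field k]
    (V : Scheme.{0}) [IsIntegral V] (f : V ⟶ Spec (.of k)) (L : Type) [Field L]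
    [Algebra V.functionField L] [LocallyOfFiniteType f] (hdeg : Module.finrank V.functionField L = p) :
    IsLocallyNoetherian (normalizationIn V L) := by
  haveI : FiniteDimensional V.functionField L :=
    Module.finite_of_finrank_pos (by rw [hdeg]; exact hp.pos)
  haveI : IsLocallyNoetherian V := LocallyOfFiniteType.isLocallyNoetherian f
  haveI : IsFinite (normalizationInι V L) := isFinite_normalizationInι V L f
  exact LocallyOfFiniteType.isLocallyNoetherian (normalizationInι V L)

/-- **Pointwise Kato charts on the normalisation of an adapted log-clean model, compatible on
overlaps** (stub `stub_charts` of crux `CleanModelsSuffice`, line `Sketch`). Let `V` be regular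
integral separated of finite type over a field `k` of characteristic `p`, `L/K(V)` purely
inseparable of degree `p`, and suppose `(V, L)` is log-clean ADAPTED to its boundary (`hR`:
pointwise presentations whose boundary sections are jointly part of regular systems where they
vanish and pairwise compatible on overlaps). Then `V^L` is locally Noetherian and is covered by
opens `W_i` carrying fs charts `φ_i : P_i → Γ(V^L, W_i)` which are log regular in Kato's sense
(2.1) at every stalk of `W_i` and pairwise compatible. [folklore] -/
theorem stub_charts
    (hK4 : ∀ (R : Type) [CommRing R] [IsNoetherianRing R] [IsLocalRing R] (n : ℕ)
      (P : AddSubmonoid (Fin n → ℤ)) (φ : Multiplicative P →* R),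
      P.FG → P.NSMulSaturated → Submodule.span ℤ (P : Set (Fin n → ℤ)) = ⊤ →
      LogChart.IsLogRegularLocal P φ → IsDomain R ∧ IsIntegrallyClosed R)
    (hNorm : ∀ {O K L : Type} [CommRing O] [IsDomain O] [Field K] [Algebra O K]
      [IsFractionRing O K] [Field L] [Algebra K L] [Algebra O L] [IsScalarTower O K L]
      (p : ℕ) (_ : p.Prime) [CharP K p] (_ : Module.finrank K L = p) (m : ℕ)
      (t : Fin (m + 1) → O) (_ : ∀ i, t i ≠ 0) (a : Fin (m + 1) → ℕ) (_ : ∀ i, ¬ p ∣ a i)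
      (y : L) (_ : y ∉ Set.range (algebraMap K L))
      (_ : y ^ p = algebraMap O L (∏ i, t i ^ a i)),
      ∃ (y' : L) (a' : Fin (m + 1) → ℕ) (c : ℕ), y' ∉ Set.range (algebraMap K L) ∧
        a' 0 = 1 ∧ (∀ i, 1 ≤ a' i ∧ a' i < p) ∧ ¬ p ∣ c ∧ (∀ i, a' i ≡ c * a i [MOD p]) ∧
        y' ^ p = algebraMap O L (∏ i, t i ^ a' i))
    (hStruct : ∀ {A K L : Type} [CommRing A] [IsRegularLocalRing A] [Field K]
      [Algebra A K] [IsFractionRing A K] [Field L] [Algebra K L] [Algebra A L] [IsScalarTower A K L]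
      (p : ℕ) (_ : p.Prime) [CharP K p] (_ : Module.finrank K L = p) (m : ℕ)
      (t : Fin (m + 1) → A) (_ : ∀ i, t i ≠ 0) (a : Fin (m + 1) → ℕ) (_ : a 0 = 1)
      (_ : ∀ i, 1 ≤ a i ∧ a i < p) (y : L) (_ : y ∉ Set.range (algebraMap K L))
      (_ : y ^ p = algebraMap A L (∏ i, t i ^ a i)) (z : Fin p → L)
      (_ : ∀ j, z j = y ^ (j : ℕ) / algebraMap A L (∏ i, t i ^ ((j : ℕ) * a i / p))),
      Subalgebra.toSubmodule (Algebra.adjoin A (Set.range z)) = Submodule.span A (Set.range z) ∧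
      LinearIndependent A z ∧ Module.Finite A (Algebra.adjoin A (Set.range z)) ∧
      IsLocalRing (Algebra.adjoin A (Set.range z)) ∧
      IsFractionRing (Algebra.adjoin A (Set.range z)) L)
    (hLogReg : ∀ {A K L : Type} [CommRing A] [IsRegularLocalRing A] [Field K]
      [Algebra A K] [IsFractionRing A K] [Field L] [Algebra K L] [Algebra A L] [IsScalarTower A K L]
      (p : ℕ) (_ : p.Prime) [CharP K p] (_ : Module.finrank K L = p) (m : ℕ)
      (t : Fin (m + 1) → A) (_ : ∀ i, t i ≠ 0) (a : Fin (m + 1) → ℕ) (_ : a 0 = 1)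
      (_ : ∀ i, 1 ≤ a i ∧ a i < p) (y : L) (_ : y ∉ Set.range (algebraMap K L))
      (_ : y ^ p = algebraMap A L (∏ i, t i ^ a i))
      (S : Finset (Fin (m + 1))) (_ : ∀ i, i ∈ S ↔ t i ∈ IsLocalRing.maximalIdeal A)
      (_ : S.Nonempty)
      (_ : IsRegularLocalRing (A ⧸ Ideal.span (t '' (S : Set (Fin (m + 1))))))
      (_ : ringKrullDim (A ⧸ Ideal.span (t '' (S : Set (Fin (m + 1))))) + (S.card : WithBot ℕ∞) =
        ringKrullDim A)
      (P : AddSubmonoid (Fin (m + 1) → ℤ))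
      (_ : ∀ c : Fin (m + 1) → ℤ, c ∈ P ↔
        0 ≤ c 0 ∧ ∀ i : Fin (m + 1), i ≠ 0 → 0 ≤ (a i : ℤ) * c 0 + (p : ℤ) * c i)
      (φ : Multiplicative P →*
        Algebra.adjoin A (Set.range fun j : Fin p =>
          y ^ (j : ℕ) / algebraMap A L (∏ i, t i ^ ((j : ℕ) * a i / p))))
      (_ : ∀ c : P, ((φ (Multiplicative.ofAdd c) : Algebra.adjoin A (Set.range fun j : Fin p =>
          y ^ (j : ℕ) / algebraMap A L (∏ i, t i ^ ((j : ℕ) * a i / p)))) : L) =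
        y ^ ((c : Fin (m + 1) → ℤ) 0) *
          ∏ i ∈ Finset.univ.erase 0, algebraMap A L (t i) ^ ((c : Fin (m + 1) → ℤ) i)),
      LogChart.IsLogRegularLocal P φ)
    (hIdeal : ∀ {A K L : Type} [CommRing A] [IsRegularLocalRing A] [Field K]
      [Algebra A K] [IsFractionRing A K] [Field L] [Algebra K L] [Algebra A L] [IsScalarTower A K L]
      (p : ℕ) (_ : p.Prime) [CharP K p] (_ : Module.finrank K L = p) (m : ℕ)
      (t : Fin (m + 1) → A) (_ : ∀ i, t i ≠ 0) (a : Fin (m + 1) → ℕ) (_ : a 0 = 1)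
      (_ : ∀ i, 1 ≤ a i ∧ a i < p) (y : L) (_ : y ∉ Set.range (algebraMap K L))
      (_ : y ^ p = algebraMap A L (∏ i, t i ^ a i))
      (S : Finset (Fin (m + 1))) (_ : ∀ i, i ∈ S ↔ t i ∈ IsLocalRing.maximalIdeal A)
      (_ : S.Nonempty)
      (P : AddSubmonoid (Fin (m + 1) → ℤ))
      (_ : ∀ c : Fin (m + 1) → ℤ, c ∈ P ↔
        0 ≤ c 0 ∧ ∀ i : Fin (m + 1), i ≠ 0 → 0 ≤ (a i : ℤ) * c 0 + (p : ℤ) * c i)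
      (φ : Multiplicative P →*
        Algebra.adjoin A (Set.range fun j : Fin p =>
          y ^ (j : ℕ) / algebraMap A L (∏ i, t i ^ ((j : ℕ) * a i / p))))
      (_ : ∀ c : P, ((φ (Multiplicative.ofAdd c) : Algebra.adjoin A (Set.range fun j : Fin p =>
          y ^ (j : ℕ) / algebraMap A L (∏ i, t i ^ ((j : ℕ) * a i / p)))) : L) =
        y ^ ((c : Fin (m + 1) → ℤ) 0) *
          ∏ i ∈ Finset.univ.erase 0, algebraMap A L (t i) ^ ((c : Fin (m + 1) → ℤ) i)),
      LogChart.nonunitIdeal P φ =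
        Ideal.span ((fun j : Fin p => (⟨y ^ (j : ℕ) / algebraMap A L (∏ i, t i ^ ((j : ℕ) * a i / p)),
            Algebra.subset_adjoin (Set.mem_range_self j)⟩ : Algebra.adjoin A (Set.range fun j : Fin p =>
              y ^ (j : ℕ) / algebraMap A L (∏ i, t i ^ ((j : ℕ) * a i / p))))) '' {j | (j : ℕ) ≠ 0}) ⊔
          (Ideal.span (t '' (S : Set (Fin (m + 1))))).map (algebraMap A _) ∧
      ∀ E : Set A,
        Function.Surjective ((Ideal.Quotient.mk (LogChart.nonunitIdeal P φ ⊔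
            (Ideal.span E).map (algebraMap A _))).comp (algebraMap A _)) ∧
        RingHom.ker ((Ideal.Quotient.mk (LogChart.nonunitIdeal P φ ⊔
            (Ideal.span E).map (algebraMap A _))).comp (algebraMap A _)) =
          Ideal.span (t '' (S : Set (Fin (m + 1)))) ⊔ Ideal.span E)
    (hAddFree : ∀ {R : Type} [CommRing R] [IsLocalRing R] {n : ℕ}
      (P : AddSubmonoid (Fin n → ℤ)) (φ : Multiplicative P →* R) (_ : LogChart.IsLogRegularLocal P φ)
      (r' : ℕ) (u : Fin r' → R) (J : Finset (Fin r')) (_ : ∀ j, j ∈ J ↔ ¬ IsUnit (u j))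
      (_ : IsRegularLocalRing (R ⧸ (LogChart.nonunitIdeal P φ ⊔ Ideal.span (u '' (J : Set (Fin r'))))))
      (_ : ringKrullDim (R ⧸ (LogChart.nonunitIdeal P φ ⊔ Ideal.span (u '' (J : Set (Fin r'))))) +
        (J.card : WithBot ℕ∞) = ringKrullDim (R ⧸ LogChart.nonunitIdeal P φ))
      (P' : AddSubmonoid (Fin (n + r') → ℤ))
      (hP' : ∀ c : Fin (n + r') → ℤ, c ∈ P' ↔
        (fun i : Fin n => c (Fin.castAdd r' i)) ∈ P ∧ ∀ j : Fin r', 0 ≤ c (Fin.natAdd n j))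
      (φ' : Multiplicative P' →* R)
      (_ : ∀ c : P', φ' (Multiplicative.ofAdd c) =
        φ (Multiplicative.ofAdd ⟨fun i : Fin n => (c : Fin (n + r') → ℤ) (Fin.castAdd r' i),
          ((hP' c).1 c.2).1⟩) *
          ∏ j : Fin r', u j ^ ((c : Fin (n + r') → ℤ) (Fin.natAdd n j)).toNat),
      LogChart.IsLogRegularLocal P' φ')
    (hMonoid : ∀ (p : ℕ) (_ : p.Prime) (m : ℕ) (a : Fin (m + 1) → ℕ) (r' : ℕ),
      (∃ (P : AddSubmonoid (Fin (m + 1) → ℤ)) (P' : AddSubmonoid (Fin ((m + 1) + r') → ℤ)),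
        (∀ c : Fin (m + 1) → ℤ, c ∈ P ↔
          0 ≤ c 0 ∧ ∀ i : Fin (m + 1), i ≠ 0 → 0 ≤ (a i : ℤ) * c 0 + (p : ℤ) * c i) ∧
        P.FG ∧ P.NSMulSaturated ∧ Submodule.span ℤ (P : Set (Fin (m + 1) → ℤ)) = ⊤ ∧
        (∀ c : Fin ((m + 1) + r') → ℤ, c ∈ P' ↔
          (fun i : Fin (m + 1) => c (Fin.castAdd r' i)) ∈ P ∧
            ∀ j : Fin r', 0 ≤ c (Fin.natAdd (m + 1) j)) ∧
        P'.FG ∧ P'.NSMulSaturated ∧ Submodule.span ℤ (P' : Set (Fin ((m + 1) + r') → ℤ)) = ⊤) ∧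
      ∃ N : AddSubmonoid (Fin r' → ℤ), (∀ c : Fin r' → ℤ, c ∈ N ↔ ∀ j, 0 ≤ c j) ∧
        N.FG ∧ N.NSMulSaturated ∧ Submodule.span ℤ (N : Set (Fin r' → ℤ)) = ⊤)
    (hSop : ∀ {O K L : Type} [CommRing O] [IsRegularLocalRing O] [Field K]
      [Algebra O K] [IsFractionRing O K] [Field L] [Algebra K L] [Algebra O L] [IsScalarTower O K L]
      [FiniteDimensional K L] (p : ℕ) (_ : p.Prime) [CharP O p] [CharP L p]
      (_ : Module.finrank K L = p) (u₀ : O) (y : L) (_ : y ∉ Set.range (algebraMap K L))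
      (_ : y ^ p = algebraMap O L u₀) (d : ℕ) (t : Fin d → O)
      (_ : Ideal.span (Set.range t) = IsLocalRing.maximalIdeal O)
      (_ : ringKrullDim O = (d : WithBot ℕ∞)) (r : ℕ) (ι : Fin r → Fin d)
      (_ : Function.Injective ι)
      (_ : (∀ x : O, u₀ - x ^ p ∉ IsLocalRing.maximalIdeal O) ∨
        (∃ x : O, u₀ - x ^ p ∈ IsLocalRing.maximalIdeal O ∧
          u₀ - x ^ p ∉ IsLocalRing.maximalIdeal O ^ 2 ⊔ Ideal.span (Set.range (t ∘ ι)))),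
      IsRegularLocalRing (integralClosure O L) ∧
        IsRegularLocalRing (integralClosure O L ⧸
          (Ideal.span (Set.range (t ∘ ι))).map (algebraMap O (integralClosure O L))) ∧
        ringKrullDim (integralClosure O L ⧸
            (Ideal.span (Set.range (t ∘ ι))).map (algebraMap O (integralClosure O L))) +
          (r : WithBot ℕ∞) = ringKrullDim (integralClosure O L))
    (p : ℕ) (hp : p.Prime)
    (k : Type) [Field k] [CharP k p] (V : Scheme.{0}) [IsIntegral V] (f : V ⟶ Spec (.of k))
    (L : Type) [Field L] [Algebra V.functionField L] [IsSeparated f] [LocallyOfFiniteType f]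
    [QuasiCompact f] (hVreg : Scheme.IsRegular V) [IsPurelyInseparable V.functionField L]
    (hdeg : Module.finrank V.functionField L = p)
    (hR : ∃ (y : V → L) (g : V → V.functionField) (d r m : V → ℕ) (hrd : ∀ v, r v ≤ d v)
        (hmr : ∀ v, m v ≤ r v) (t : ∀ v : V, Fin (d v) → V.presheaf.stalk v) (a : ∀ v : V, Fin (m v) → ℕ)
        (U : V → V.Opens) (hU : ∀ v, v ∈ U v) (s : ∀ v : V, Fin (r v) → Γ(V, U v)),
        (∀ v : V, y v ∉ Set.range (algebraMap V.functionField L) ∧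
          algebraMap V.functionField L (g v) = y v ^ p ∧
          Ideal.span (Set.range (t v)) = IsLocalRing.maximalIdeal (V.presheaf.stalk v) ∧
          ringKrullDim (V.presheaf.stalk v) = (d v : WithBot ℕ∞) ∧
          (∀ i : Fin (r v), V.presheaf.germ (U v) v (hU v) (s v i) = t v (Fin.castLE (hrd v) i)) ∧
          (∀ i : Fin (m v), ¬ p ∣ a v i) ∧
          ((0 < m v ∧ g v = ∏ i : Fin (m v),
              (algebraMap (V.presheaf.stalk v) V.functionField
                (t v (Fin.castLE ((hmr v).trans (hrd v)) i))) ^ (a v i)) ∨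
            (m v = 0 ∧ ∃ u₀ : V.presheaf.stalk v, IsUnit u₀ ∧
              g v = algebraMap (V.presheaf.stalk v) V.functionField u₀ ∧
              ((∀ x : V.presheaf.stalk v, u₀ - x ^ p ∉ IsLocalRing.maximalIdeal (V.presheaf.stalk v)) ∨
                (∃ x : V.presheaf.stalk v, u₀ - x ^ p ∈ IsLocalRing.maximalIdeal (V.presheaf.stalk v) ∧
                  u₀ - x ^ p ∉ IsLocalRing.maximalIdeal (V.presheaf.stalk v) ^ 2 ⊔
                    Ideal.span (Set.range fun i : Fin (r v) => t v (Fin.castLE (hrd v) i))))))) ∧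
        (∀ (v w : V) (hw : w ∈ U v), ∃ (dw : ℕ) (tw : Fin dw → V.presheaf.stalk w) (ι : Fin (r v) → Fin dw),
          Ideal.span (Set.range tw) = IsLocalRing.maximalIdeal (V.presheaf.stalk w) ∧
          ringKrullDim (V.presheaf.stalk w) = (dw : WithBot ℕ∞) ∧
          (∀ i : Fin (r v), V.presheaf.germ (U v) w hw (s v i) ∈ IsLocalRing.maximalIdeal (V.presheaf.stalk w) →
            tw (ι i) = V.presheaf.germ (U v) w hw (s v i)) ∧
          (∀ i j : Fin (r v), V.presheaf.germ (U v) w hw (s v i) ∈ IsLocalRing.maximalIdeal (V.presheaf.stalk w) →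
            V.presheaf.germ (U v) w hw (s v j) ∈ IsLocalRing.maximalIdeal (V.presheaf.stalk w) → ι i = ι j → i = j)) ∧
        (∀ (v v' w : V) (hw : w ∈ U v) (hw' : w ∈ U v'), ∃ μ : ℕ, ¬ p ∣ μ ∧ ∀ i : Fin (r v),
          V.presheaf.germ (U v) w hw (s v i) ∈ IsLocalRing.maximalIdeal (V.presheaf.stalk w) →
          ∃ i' : Fin (r v'), Associated (V.presheaf.germ (U v) w hw (s v i))
              (V.presheaf.germ (U v') w hw' (s v' i')) ∧
            ((i : ℕ) < m v ↔ (i' : ℕ) < m v') ∧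
            (∀ (hi : (i : ℕ) < m v) (hi' : (i' : ℕ) < m v'), a v' ⟨i', hi'⟩ ≡ μ * a v ⟨i, hi⟩ [MOD p]))) :
    IsLocallyNoetherian (normalizationIn V L) ∧
    ∃ (ι : Type) (W : ι → (normalizationIn V L).Opens) (n : ι → ℕ)
      (P : ∀ i, AddSubmonoid (Fin (n i) → ℤ))
      (φ : ∀ i, Multiplicative (P i) →* Γ(normalizationIn V L, W i)),
      (∀ x : normalizationIn V L, ∃ i, x ∈ W i) ∧
      (∀ i, (P i).FG ∧ (P i).NSMulSaturated ∧
        Submodule.span ℤ (P i : Set (Fin (n i) → ℤ)) = ⊤) ∧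
      (∀ i (x : normalizationIn V L) (hx : x ∈ W i), LogChart.IsLogRegularLocal (P i)
        (((normalizationIn V L).presheaf.germ (W i) x hx).hom.toMonoidHom.comp (φ i))) ∧
      (∀ i j (x : normalizationIn V L) (hi : x ∈ W i) (hj : x ∈ W j) (c : P i), ∃ c' : P j,
        Associated ((normalizationIn V L).presheaf.germ (W i) x hi (φ i (Multiplicative.ofAdd c)))
          ((normalizationIn V L).presheaf.germ (W j) x hj (φ j (Multiplicative.ofAdd c')))) := by
  -- acknowledge the finer local algebra that the charged-only charts do not need
  have _hI := @hIdeal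
  have _hA := @hAddFree
  have _hM := @hMonoid
  have _hS := @hSop
  haveI : CharP V.functionField p := Picover.TowerTransport.charP_functionField V f
  refine ⟨isLocallyNoetherian_normalizationIn_of_finrank p hp k V f L hdeg, ?_⟩
  · obtain ⟨y, g, d, r, m, hrd, hmr, t, a, U, hU, s, hpt, hjoint, hover⟩ := hR
    let D : AdaptedData p V L := ⟨y, g, d, r, m, hrd, hmr, t, a, U, hU, s, hpt, hjoint, hover⟩
    exact ⟨{v : V // 0 < D.m v} ⊕ V, D.W, D.n, D.P hNorm hp hdeg, D.chart hNorm hp hdeg, D.cover,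
      D.fs hNorm hp hdeg, D.isLogRegularLocal_chart hNorm hp hdeg hVreg hK4 hStruct hLogReg,
      D.chart_compatible hNorm hp hdeg hVreg hK4 hStruct hLogReg⟩

end Summit.ResolutionOfSingularities.ResolutionOfSingularities.Theorems.RadicialJung.CleanModelsSuffice

end
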